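import Summits.QuantumFields.YangMills.Theorems.DirichletWindowAllSidesChessboardTwistedOddCore
import Literature.Probability.LatticeModels.ChessboardEstimateEvenTorus
import HarnessLib

/-!
# The twisted two-class chessboard estimate on a block torus of EVEN side — core bookkeeping

Support file for item stmt-QuantumFields-20194 (`DirichletWindow.AllSidesCouplingChessboard`, K1 of the large-field
sparsity line; seat ym-dw-p1 g3).  Part 1 (of 3; part 2 `…EvenTranslate`, part 3 `…Even`) of the even-side analogue of `…AllSidesChessboardTwistedOdd{Core,}`.

On the even torus `(ℤ/N)^d`, `N = 2m`, a set of plaquettes of the Wilson theory is again a family `A = (A_o)_o` of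
block patterns, one per orientation, now with the PLAIN dictionary `c ↦ (c, o)` (corner `c`).  Along the axis `i` the
plaquettes of an orientation `o ∌ i` are LAYER objects (they lie in the hyperplane `x_i = c_i`), those of an
orientation `o ∋ i` are SLAB objects (they span `[c_i, c_i + 1]`).  The torus has two families of reflections of the
axis `i`: the LINK reflections `x_i ↦ 2k - 1 - x_i` (hyperplanes between sites) and the SITE reflections
`x_i ↦ 2k - x_i` (hyperplanes through sites).  A link reflection acts on layers by the tree's block reflection
`cellReflect i k : c_i ↦ 2k - 1 - c_i` (no fixed layer, OPEN halves `halfPlus/halfMinus`, symmetrisations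
`symP/symM i k`) but on slabs by the SITE-TYPE block reflection `c_i ↦ 2(k-1) - c_i`, which FIXES the two cut slabs
`c_i = k - 1` and `c_i = k - 1 + m`; a site reflection acts on layers by `c_i ↦ 2k - c_i` (fixing the two shared layers
`k`, `k + m`) and on slabs by `cellReflect i k`.  This file introduces the site-type block reflection `sreflect i j`,
its CLOSED half-lines `shalfP/shalfM i j` (`{j, …, j+m}` and `{j+m, …, j+2m = j}`, overlapping in the two fixed
blocks) and symmetrisations `ssymP/ssymM i j`, and proves: the exponent count `#ssymP + #ssymM = 2·#`
(`card_ssymP_add_card_ssymM`), the cylinder-preservation lemmas, the gluing lemmas for the corresponding moves on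
assignments of slices (`glue_oplus`, `glue_splus`).
Finite combinatorics only.

References: J. Fröhlich, R. Israel, E. H. Lieb, B. Simon, Comm. Math. Phys. 62 (1978) 1–34, Thm. 2.2/4.1; J. Fröhlich,
E. H. Lieb, Comm. Math. Phys. 60 (1978) 233–267, Thm. 2.2/2.3.  Nothing here is a statement about the Yang–Mills gap.
-/

noncomputable section

open Finset
open Literature.Barriers.CriticalPhenomena.NonGibbs
open Literature.Probability.LatticeModels

namespace Summit.QuantumFields.YangMills.Theorems.AllSidesChessboard

/-! ### §1. The site-type block reflection and its closed half-lines -/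

section SiteType

variable {d N : ℕ}

/-- **The site-type reflection of the axis `i` through the block `j`**: `c ↦ c[i ↦ 2j - cᵢ]`.  An involution fixing
the blocks with `cᵢ = j` and (for even `N = 2m`) `cᵢ = j + m`. -/
def sreflect (i : Fin d) (j : ZMod N) : BlockIdx d N ≃ BlockIdx d N where
  toFun c := Function.update c i (2 * j - c i)
  invFun c := Function.update c i (2 * j - c i)
  left_inv c := by
    ext l; by_cases h : l = i
    · subst h; simp
    · simp [h]
  right_inv c := by
    ext l; by_cases h : l = i
    · subst h; simp
    · simp [h]

/-- Pointwise formula for `sreflect`. -/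
@[simp] theorem sreflect_apply (i : Fin d) (j : ZMod N) (c : BlockIdx d N) :
    sreflect i j c = Function.update c i (2 * j - c i) := rfl

/-- `sreflect` is an involution. -/
theorem sreflect_sreflect (i : Fin d) (j : ZMod N) (c : BlockIdx d N) : sreflect i j (sreflect i j c) = c :=
  (sreflect i j).left_inv c

/-- The reflected `i`-th coordinate measured from `j`: `(θc)ᵢ - j = -(cᵢ - j)`. -/
theorem sreflect_apply_same_sub (i : Fin d) (j : ZMod N) (c : BlockIdx d N) :
    sreflect i j c i - j = -(c i - j) := by
  simp only [sreflect_apply, Function.update_self]; ring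

/-- The other coordinates are unchanged. -/
theorem sreflect_apply_of_ne (i : Fin d) (j : ZMod N) (c : BlockIdx d N) {l : Fin d} (h : l ≠ i) :
    sreflect i j c l = c l := by
  simp [h]

variable [NeZero N]

variable (N) in
/-- **The closed positive half-line of the site-type reflection**: blocks with `(cᵢ - j).val ≤ N/2`, i.e.
`cᵢ ∈ {j, …, j + N/2}`. -/
def shalfP (i : Fin d) (j : ZMod N) : Finset (BlockIdx d N) :=
  univ.filter fun c => (c i - j).val ≤ N / 2

variable (N) in
/-- **The closed negative half-line of the site-type reflection**: blocks with `N/2 ≤ (cᵢ - j).val` or `cᵢ = j`, i.e.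
`cᵢ ∈ {j + N/2, …, j + N = j}`. -/
def shalfM (i : Fin d) (j : ZMod N) : Finset (BlockIdx d N) :=
  univ.filter fun c => N / 2 ≤ (c i - j).val ∨ (c i - j).val = 0

/-- Membership in `shalfP`. -/
@[simp] theorem mem_shalfP {i : Fin d} {j : ZMod N} {c : BlockIdx d N} :
    c ∈ shalfP N i j ↔ (c i - j).val ≤ N / 2 := by simp [shalfP]

/-- Membership in `shalfM`. -/
@[simp] theorem mem_shalfM {i : Fin d} {j : ZMod N} {c : BlockIdx d N} :
    c ∈ shalfM N i j ↔ N / 2 ≤ (c i - j).val ∨ (c i - j).val = 0 := by simp [shalfM]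

/-- The value of the reflected relative coordinate. -/
theorem val_sreflect_sub (i : Fin d) (j : ZMod N) (c : BlockIdx d N) :
    (sreflect i j c i - j).val = if (c i - j).val = 0 then 0 else N - (c i - j).val := by
  rw [sreflect_apply_same_sub, ZMod.neg_val]
  by_cases h : c i - j = 0
  · rw [if_pos h, if_pos (by rw [h, ZMod.val_zero])]
  · rw [if_neg h, if_neg (fun h' => h ((ZMod.val_eq_zero _).1 h'))]

/-- The reflection maps the closed positive half-line into the closed negative one (even `N`). -/
theorem sreflect_mem_shalfM (hN : Even N) {i : Fin d} {j : ZMod N} {c : BlockIdx d N} (hc : c ∈ shalfP N i j) :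
    sreflect i j c ∈ shalfM N i j := by
  rw [mem_shalfP] at hc
  rw [mem_shalfM, val_sreflect_sub]
  obtain ⟨m, hm⟩ := hN
  split_ifs with h
  · exact Or.inr rfl
  · left; omega

/-- The reflection maps the closed negative half-line into the closed positive one (even `N`). -/
theorem sreflect_mem_shalfP (hN : Even N) {i : Fin d} {j : ZMod N} {c : BlockIdx d N} (hc : c ∈ shalfM N i j) :
    sreflect i j c ∈ shalfP N i j := by
  rw [mem_shalfM] at hc
  rw [mem_shalfP, val_sreflect_sub]
  have := ZMod.val_lt (c i - j)
  obtain ⟨m, hm⟩ := hN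
  split_ifs with h
  · exact Nat.zero_le _
  · omega

/-- Every block lies in one of the two closed half-lines. -/
theorem mem_shalfP_or_mem_shalfM (i : Fin d) (j : ZMod N) (c : BlockIdx d N) :
    c ∈ shalfP N i j ∨ c ∈ shalfM N i j := by
  rw [mem_shalfP, mem_shalfM]; omega

/-- A block in both closed half-lines is fixed by the reflection (even `N`). -/
theorem sreflect_eq_self_of_mem_mem (hN : Even N) {i : Fin d} {j : ZMod N} {c : BlockIdx d N}
    (hP : c ∈ shalfP N i j) (hM : c ∈ shalfM N i j) : sreflect i j c = c := by
  rw [mem_shalfP] at hP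
  rw [mem_shalfM] at hM
  have hv : (sreflect i j c i - j).val = (c i - j).val := by
    rw [val_sreflect_sub]
    obtain ⟨m, hm⟩ := hN
    split_ifs with h
    · exact h.symm
    · omega
  have hi : sreflect i j c i = c i := by
    have := ZMod.val_injective N hv
    exact sub_left_injective this
  ext l
  by_cases hl : l = i
  · subst hl; exact hi
  · exact sreflect_apply_of_ne i j c hl

/-- **Site-type symmetrisation in the closed positive half-line**: `(B ∩ C₊) ∪ θ(B ∩ C₊)`. -/
def ssymP (i : Fin d) (j : ZMod N) (B : Finset (BlockIdx d N)) : Finset (BlockIdx d N) :=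
  (B ∩ shalfP N i j) ∪ (B ∩ shalfP N i j).image (sreflect i j)

/-- **Site-type symmetrisation in the closed negative half-line**: `(B ∩ C₋) ∪ θ(B ∩ C₋)`. -/
def ssymM (i : Fin d) (j : ZMod N) (B : Finset (BlockIdx d N)) : Finset (BlockIdx d N) :=
  (B ∩ shalfM N i j) ∪ (B ∩ shalfM N i j).image (sreflect i j)

/-- The overlap of `B ∩ C₊` with its reflection is the fixed part `B ∩ C₊ ∩ C₋`. -/
theorem inter_shalfP_inter_image (hN : Even N) (i : Fin d) (j : ZMod N) (B : Finset (BlockIdx d N)) :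
    (B ∩ shalfP N i j) ∩ (B ∩ shalfP N i j).image (sreflect i j) = B ∩ shalfP N i j ∩ shalfM N i j := by
  ext c
  simp only [mem_inter, mem_image]
  constructor
  · rintro ⟨⟨hcB, hcP⟩, b, ⟨hbB, hbP⟩, rfl⟩
    exact ⟨⟨hcB, hcP⟩, sreflect_mem_shalfM hN hbP⟩
  · rintro ⟨⟨hcB, hcP⟩, hcM⟩
    exact ⟨⟨hcB, hcP⟩, c, ⟨hcB, hcP⟩, sreflect_eq_self_of_mem_mem hN hcP hcM⟩

/-- The overlap of `B ∩ C₋` with its reflection is the fixed part `B ∩ C₊ ∩ C₋`. -/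
theorem inter_shalfM_inter_image (hN : Even N) (i : Fin d) (j : ZMod N) (B : Finset (BlockIdx d N)) :
    (B ∩ shalfM N i j) ∩ (B ∩ shalfM N i j).image (sreflect i j) = B ∩ shalfP N i j ∩ shalfM N i j := by
  ext c
  simp only [mem_inter, mem_image]
  constructor
  · rintro ⟨⟨hcB, hcM⟩, b, ⟨hbB, hbM⟩, rfl⟩
    exact ⟨⟨hcB, sreflect_mem_shalfP hN hbM⟩, hcM⟩
  · rintro ⟨⟨hcB, hcP⟩, hcM⟩
    exact ⟨⟨hcB, hcM⟩, c, ⟨hcB, hcM⟩, sreflect_eq_self_of_mem_mem hN hcP hcM⟩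

/-- **The exponents match for the site-type symmetrisations**: `#ssymP B + #ssymM B = 2 #B` (even `N`; the two closed
half-lines cover everything and overlap exactly in the fixed blocks, each of which is kept once by each
symmetrisation). -/
theorem card_ssymP_add_card_ssymM (hN : Even N) (i : Fin d) (j : ZMod N) (B : Finset (BlockIdx d N)) :
    #(ssymP i j B) + #(ssymM i j B) = 2 * #B := by
  have hP : #(ssymP i j B) + #(B ∩ shalfP N i j ∩ shalfM N i j) = #(B ∩ shalfP N i j) + #(B ∩ shalfP N i j) := by
    rw [ssymP, ← inter_shalfP_inter_image hN i j B, card_union_add_card_inter,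
      card_image_of_injective _ (sreflect i j).injective]
  have hM : #(ssymM i j B) + #(B ∩ shalfP N i j ∩ shalfM N i j) = #(B ∩ shalfM N i j) + #(B ∩ shalfM N i j) := by
    rw [ssymM, ← inter_shalfM_inter_image hN i j B, card_union_add_card_inter,
      card_image_of_injective _ (sreflect i j).injective]
  have hU : #(B ∩ shalfP N i j) + #(B ∩ shalfM N i j) = #B + #(B ∩ shalfP N i j ∩ shalfM N i j) := by
    rw [← card_union_add_card_inter, ← inter_union_distrib_left,
      inter_eq_left.2 (fun c _ => mem_union.2 (mem_shalfP_or_mem_shalfM i j c))]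
    congr 2
    ext c; simp only [mem_inter]; tauto
  omega

end SiteType

/-! ### §2. Cylinders are preserved -/

section Cyl

variable {d N : ℕ} [NeZero N]

omit [NeZero N] in
/-- The site-type reflection commutes with updating another coordinate. -/
theorem sreflect_update {i j : Fin d} (h : j ≠ i) (k : ZMod N) (b : BlockIdx d N) (t : ZMod N) :
    sreflect i k (Function.update b j t) = Function.update (sreflect i k b) j t := by
  ext l
  simp only [sreflect_apply]
  by_cases hlj : l = j
  · subst hlj
    rw [Function.update_self, Function.update_of_ne h, Function.update_self]
  · rw [Function.update_of_ne hlj]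
    by_cases hli : l = i
    · subst hli
      rw [Function.update_self, Function.update_self, Function.update_of_ne hlj]
    · rw [Function.update_of_ne hli, Function.update_of_ne hli, Function.update_of_ne hlj]

/-- A cylinder along `j` stays a cylinder along `j` under the open positive symmetrisation of another axis. -/
theorem cyl_symP {i j : Fin d} (h : j ≠ i) (k : ZMod N) {B : Finset (BlockIdx d N)}
    (hB : ∀ c ∈ B, ∀ t : ZMod N, Function.update c j t ∈ B) :
    ∀ c ∈ symP i k B, ∀ t : ZMod N, Function.update c j t ∈ symP i k B := by
  intro c hc t
  rw [symP, mem_union, mem_inter, mem_image] at hc ⊢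
  rcases hc with ⟨hcB, hcC⟩ | ⟨b, hb, rfl⟩
  · refine Or.inl ⟨hB c hcB t, ?_⟩
    rw [mem_halfPlus] at hcC ⊢
    rwa [Function.update_of_ne (Ne.symm h)]
  · obtain ⟨hbB, hbC⟩ := mem_inter.1 hb
    refine Or.inr ⟨Function.update b j t, mem_inter.2 ⟨hB b hbB t, ?_⟩, cellReflect_update h k b t⟩
    rw [mem_halfPlus] at hbC ⊢
    rwa [Function.update_of_ne (Ne.symm h)]

/-- A cylinder along `j` stays a cylinder along `j` under the site-type positive symmetrisation of another axis. -/
theorem cyl_ssymP {i j : Fin d} (h : j ≠ i) (k : ZMod N) {B : Finset (BlockIdx d N)}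
    (hB : ∀ c ∈ B, ∀ t : ZMod N, Function.update c j t ∈ B) :
    ∀ c ∈ ssymP i k B, ∀ t : ZMod N, Function.update c j t ∈ ssymP i k B := by
  intro c hc t
  rw [ssymP, mem_union, mem_inter, mem_image] at hc ⊢
  rcases hc with ⟨hcB, hcC⟩ | ⟨b, hb, rfl⟩
  · refine Or.inl ⟨hB c hcB t, ?_⟩
    rw [mem_shalfP] at hcC ⊢
    rwa [Function.update_of_ne (Ne.symm h)]
  · obtain ⟨hbB, hbC⟩ := mem_inter.1 hb
    refine Or.inr ⟨Function.update b j t, mem_inter.2 ⟨hB b hbB t, ?_⟩, sreflect_update h k b t⟩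
    rw [mem_shalfP] at hbC ⊢
    rwa [Function.update_of_ne (Ne.symm h)]

/-- A cylinder along `j` stays a cylinder along `j` under the site-type negative symmetrisation of another axis. -/
theorem cyl_ssymM {i j : Fin d} (h : j ≠ i) (k : ZMod N) {B : Finset (BlockIdx d N)}
    (hB : ∀ c ∈ B, ∀ t : ZMod N, Function.update c j t ∈ B) :
    ∀ c ∈ ssymM i k B, ∀ t : ZMod N, Function.update c j t ∈ ssymM i k B := by
  intro c hc t
  rw [ssymM, mem_union, mem_inter, mem_image] at hc ⊢
  rcases hc with ⟨hcB, hcC⟩ | ⟨b, hb, rfl⟩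
  · refine Or.inl ⟨hB c hcB t, ?_⟩
    rw [mem_shalfM] at hcC ⊢
    rwa [Function.update_of_ne (Ne.symm h)]
  · obtain ⟨hbB, hbC⟩ := mem_inter.1 hb
    refine Or.inr ⟨Function.update b j t, mem_inter.2 ⟨hB b hbB t, ?_⟩, sreflect_update h k b t⟩
    rw [mem_shalfM] at hbC ⊢
    rwa [Function.update_of_ne (Ne.symm h)]

end Cyl

/-! ### §3. Moves on assignments of slices and their gluing -/

section Moves

variable {d N : ℕ} [NeZero N] {ι : Type*}

/-- **The open plus-move at the boundary `k`** on assignments of the even cycle: keep the open half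
`{k, …, k + N/2 - 1}` and reflect it (`t ↦ 2k - 1 - t`) onto the rest. -/
def oplus (k : ZMod N) (σ : ZMod N → ι) : ZMod N → ι :=
  fun t => if (t - k).val < N / 2 then σ t else σ (2 * k - 1 - t)

/-- **The site-type plus-move through `j`**: keep the closed half `{j, …, j + N/2}` and reflect it (`t ↦ 2j - t`) onto
the rest. -/
def splus (j : ZMod N) (σ : ZMod N → ι) : ZMod N → ι :=
  fun t => if (t - j).val ≤ N / 2 then σ t else σ (2 * j - t)

omit [NeZero N] in
/-- The open plus-move of a constant assignment is constant. -/
theorem oplus_const (k : ZMod N) (x : ι) : oplus k (fun _ => x) = fun _ => x := by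
  funext t; unfold oplus; split_ifs <;> rfl

omit [NeZero N] in
/-- The site-type plus-move of a constant assignment is constant. -/
theorem splus_const (j : ZMod N) (x : ι) : splus j (fun _ => x) = fun _ => x := by
  funext t; unfold splus; split_ifs <;> rfl

omit [NeZero N] in
/-- Reflecting an `update`d block with `cellReflect`. -/
theorem cellReflect_update_same (i : Fin d) (k : ZMod N) (c' : BlockIdx d N) (t : ZMod N) :
    cellReflect i k (Function.update c' i t) = Function.update c' i (2 * k - 1 - t) := by
  ext l; by_cases h : l = i
  · subst h; simp only [cellReflect_apply, Function.update_self]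
  · simp [h]

omit [NeZero N] in
/-- Reflecting an `update`d block with `sreflect`. -/
theorem sreflect_update_same (i : Fin d) (j : ZMod N) (c' : BlockIdx d N) (t : ZMod N) :
    sreflect i j (Function.update c' i t) = Function.update c' i (2 * j - t) := by
  ext l; by_cases h : l = i
  · subst h; simp only [sreflect_apply, Function.update_self]
  · simp [h]

/-- **Gluing the open plus-move is the open positive symmetrisation of the glued set** (even `N`). -/
theorem glue_oplus (hN : Even N) (i : Fin d) (k : ZMod N) (σ : ZMod N → Finset (BlockIdx d N)) :
    glueSlices i (oplus k σ) = symP i k (glueSlices i σ) := by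
  ext c
  rw [symP, mem_union, mem_inter, mem_image, mem_glueSlices, mem_halfPlus]
  constructor
  · rintro ⟨c', hc', hc⟩
    by_cases hp : (c i - k).val < N / 2
    · rw [oplus, if_pos hp] at hc'
      exact Or.inl ⟨mem_glueSlices.2 ⟨c', hc', hc⟩, hp⟩
    · rw [oplus, if_neg hp] at hc'
      have hcm : c ∈ halfMinus N i k := mem_halfMinus.2 (not_lt.1 hp)
      refine Or.inr ⟨cellReflect i k c, mem_inter.2 ⟨?_, cellReflect_mem_halfPlus hN hcm⟩, cellReflect_cellReflect i k c⟩
      rw [mem_glueSlices]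
      refine ⟨c', ?_, ?_⟩
      · simp only [cellReflect_apply, Function.update_self]; exact hc'
      · rw [← hc, cellReflect_update_same, Function.update_self]
  · rintro (⟨hc, hp⟩ | ⟨b, hb, rfl⟩)
    · obtain ⟨c', hc', hc⟩ := mem_glueSlices.1 hc
      exact ⟨c', by rw [oplus, if_pos hp]; exact hc', hc⟩
    · obtain ⟨hb, hbp⟩ := mem_inter.1 hb
      obtain ⟨b', hb', hbb⟩ := mem_glueSlices.1 hb
      have hθm : cellReflect i k b ∈ halfMinus N i k := cellReflect_mem_halfMinus hN hbp
      have hnot : ¬ ((cellReflect i k b) i - k).val < N / 2 := not_lt.2 (mem_halfMinus.1 hθm)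
      refine ⟨b', ?_, ?_⟩
      · rw [oplus, if_neg hnot]
        simp only [cellReflect_apply, Function.update_self]
        rw [show 2 * k - 1 - (2 * k - 1 - b i) = b i by ring]
        exact hb'
      · rw [← hbb, cellReflect_update_same, Function.update_self]

/-- **Gluing the site-type plus-move is the site-type positive symmetrisation of the glued set** (even `N`). -/
theorem glue_splus (hN : Even N) (i : Fin d) (j : ZMod N) (σ : ZMod N → Finset (BlockIdx d N)) :
    glueSlices i (splus j σ) = ssymP i j (glueSlices i σ) := by
  ext c
  rw [ssymP, mem_union, mem_inter, mem_image, mem_glueSlices, mem_shalfP]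
  constructor
  · rintro ⟨c', hc', hc⟩
    by_cases hp : (c i - j).val ≤ N / 2
    · rw [splus, if_pos hp] at hc'
      exact Or.inl ⟨mem_glueSlices.2 ⟨c', hc', hc⟩, hp⟩
    · rw [splus, if_neg hp] at hc'
      have hcm : c ∈ shalfM N i j := mem_shalfM.2 (Or.inl (not_le.1 hp).le)
      refine Or.inr ⟨sreflect i j c, mem_inter.2 ⟨?_, sreflect_mem_shalfP hN hcm⟩, sreflect_sreflect i j c⟩
      rw [mem_glueSlices]
      refine ⟨c', ?_, ?_⟩
      · simp only [sreflect_apply, Function.update_self]; exact hc'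
      · rw [← hc, sreflect_update_same, Function.update_self]
  · rintro (⟨hc, hp⟩ | ⟨b, hb, rfl⟩)
    · obtain ⟨c', hc', hc⟩ := mem_glueSlices.1 hc
      exact ⟨c', by rw [splus, if_pos hp]; exact hc', hc⟩
    · obtain ⟨hb, hbp⟩ := mem_inter.1 hb
      obtain ⟨b', hb', hbb⟩ := mem_glueSlices.1 hb
      by_cases hfix : (sreflect i j b i - j).val ≤ N / 2
      · -- `b` is fixed: `θ b = b`
        have hbM : b ∈ shalfM N i j := by
          have h := sreflect_mem_shalfM hN (mem_shalfP.2 hfix)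
          rwa [sreflect_sreflect] at h
        rw [sreflect_eq_self_of_mem_mem hN hbp hbM]
        exact ⟨b', by rw [splus, if_pos (mem_shalfP.1 hbp)]; exact hb', hbb⟩
      · refine ⟨b', ?_, ?_⟩
        · rw [splus, if_neg hfix]
          simp only [sreflect_apply, Function.update_self]
          rw [show 2 * j - (2 * j - b i) = b i by ring]
          exact hb'
        · rw [← hbb, sreflect_update_same, Function.update_self]

end Moves

end Summit.QuantumFields.YangMills.Theorems.AllSidesChessboard

end
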